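import Summits.Parity.GeneralizedHardyLittlewood.Theses.FordMaynardSieveConst01651
import HarnessLib

/-!
# `FMThm73aLevelHalf` (stmt-Parity-19187) holds VACUOUSLY; `GCert01651` (stmt-Parity-19186) is REFUTABLE —
# the closed point `x = (1/2, 1/2)` (line-writer census, seat `linewriter-parity-smallroutes-1` g0, 2026-08-31)

Route `FordMaynardSieveConst01651` (Parity / GeneralizedHardyLittlewood).

THE DEFECT (one line).  In the tree's transcription of Ford–Maynard Theorem 7.3 (a)
(`Literature.NumberTheory.Sieve.FordMaynard.FordMaynard2024_thm73a_levelHalf`) — and, copied from it, in the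
crux `GCert01651` — the support hypothesis is STRICT, `g k x ≠ 0 → k = 0 ∨ (… ∧ ∑ i, x i < 1/2)`, while the
sign hypothesis `(𝟙⋆g)(x) ≤ 0` is demanded at EVERY `x` of dimension `k ≥ 2` with `ν < xᵢ < 1 − ν` and
`∑ xᵢ = 1`.  For `ν < 1/4` the point `x = (1/2, 1/2)` qualifies (`ν < 1/2 < 1 − ν`), and for every `g` with
`g(∅) = 1` and the strict support one has
`(𝟙⋆g)(1/2, 1/2) = g(∅) + 2·g(1/2) + g(1/2, 1/2) = 1 + 0 + 0 = 1 > 0`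
(`g(1/2) = 0` because `|(1/2)| = 1/2` is not `< 1/2`).  Hence the two hypotheses are jointly unsatisfiable:

* `FordMaynard2024_thm73a_levelHalf` — and so the route item `FMThm73aLevelHalf` — is provable outright
  (`FMThm73aLevelHalf_holds` below, NO `sorry`): the named fact is VACUOUS as typed;
* `GCert01651` is false (`not_GCert01651` below, NO `sorry`): no `g` can satisfy clauses 3–5 simultaneously;
* the registered lines `Cruxes/GCert01651/Lines/cone_table.lean` and `Cruxes/SieveConst01651/Lines/cone_table_bridge.lean`
  (this seat, earlier today) inherit the defect: their common stub `stub_coneCert` is false (`not_stub_coneCert` below —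
  the constant vector `(1/2, 1/2)` is monotone, so the cone restriction does not save it).  DIAGNOSIS filed on both cards.

IN PRINT there is no contradiction: Ford–Maynard's `𝒢₁ = {x ∈ 𝒵 : xᵢ ≥ ν, |x| + ψ(x) ≤ γ}` ((7.1), p. 27) has the
NON-strict `|x| ≤ 1/2` at `P = (1/2, 0, ν)` (`ψ ≡ 0` there), the one-dimensional vector `(1/2)` lies in `𝒢₁`
(`(1/2, 1/2) ∈ 𝒞(ℛ)` as the coagulation of `(1/4, 1/4, 1/4, 1/4) ∈ ℛ`), and the `ℋ`-condition at `(1/2, 1/2) ∈ ℋ(P)`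
(Lemma 8.4: `1/2 ∈ (2ν, 1 − ν)`) simply forces `g(1/2) ≤ −1/2`.  The tree's docstring argument "𝒢₁' = {∅} ∪ {all xᵢ > ν,
|x| < 1/2} ⊆ 𝒢₁, so the restricted fact is implied by the printed theorem" is correct — the restricted fact IS implied,
but it is implied because it is vacuous.

REPAIR (for the tenure planner / operator; not this seat's remit): restate the support clause with `∑ i, x i ≤ 1/2`
(still a subset of `𝒢₁`, by the same coagulation argument), in BOTH the Literature fact and the crux, and re-certify the
LP table with the boundary `|y| = 1/2` included (the sign condition on the closed set `{ν < xᵢ < 1 − ν, ∑ xᵢ = 1}` then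
needs `g₁(1/2) ≤ −1/2` and, from `x = (t, 1 − t)`, `g₁(t) ≤ −1` on `(ν, 1/2)`; lower-dimensional polytope pieces carry
measure zero, so `sieveBoundG1` is unchanged).  Until then `SieveConst01651` (stmt-Parity-19185) has no live line:
`GCert01651 → FMThm73aLevelHalf → SieveConst01651` is `False → True → S`.
-/

noncomputable section

open Finset
open Literature.NumberTheory.Sieve Literature.NumberTheory.Sieve.FordMaynard

namespace Summit.Parity.GeneralizedHardyLittlewood.Cruxes.FMThm73aLevelHalf.ClosedPoint

/-- The computation behind everything: if `g(∅) = 1` and `g` vanishes off `{k = 0} ∪ {∑ xᵢ < 1/2}` (any lower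
bound `ν` on the components), then `(𝟙⋆g)` of the constant vector `(1/2, …, 1/2)` equals `1` in every dimension
(only the empty subvector contributes). -/
theorem starSum_const_half {g : VecFn} {ν : ℝ} (h0 : ∀ e : Fin 0 → ℝ, g 0 e = 1)
    (hsupp : ∀ (k : ℕ) (x : Fin k → ℝ), g k x ≠ 0 → k = 0 ∨ ((∀ i, ν < x i) ∧ ∑ i, x i < 1 / 2))
    (k : ℕ) : starSum g k (fun _ => (1 / 2 : ℝ)) = 1 := by
  classical
  have h0' : ∀ (m : ℕ), m = 0 → ∀ e : Fin m → ℝ, g m e = 1 := by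
    rintro m rfl e; exact h0 e
  unfold starSum
  have key : ∀ A : Finset (Fin k),
      g A.card (fun i => (fun _ : Fin k => (1 / 2 : ℝ)) (A.orderEmbOfFin rfl i)) = if A = ∅ then 1 else 0 := by
    intro A
    by_cases hA : A = ∅
    · rw [if_pos hA]
      exact h0' _ (by rw [hA]; rfl) _
    · rw [if_neg hA]
      by_contra hne
      rcases hsupp _ _ hne with h | ⟨-, hlt⟩
      · exact hA (Finset.card_eq_zero.1 h)
      · simp only [Finset.sum_const, Finset.card_univ, Fintype.card_fin, nsmul_eq_mul] at hlt
        have h1 : (1 : ℝ) ≤ A.card := by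
          exact_mod_cast Finset.card_pos.2 (Finset.nonempty_iff_ne_empty.2 hA)
        linarith
  simp_rw [key]
  simp

/-- **`FMThm73aLevelHalf` holds — vacuously** (route `FordMaynardSieveConst01651`, item stmt-Parity-19187; the
decl unfolds to `FordMaynard2024_thm73a_levelHalf`): for `ν < 1/4` the hypotheses `g(∅) = 1`, strict support and
`(𝟙⋆g) ≤ 0` on `{dim ≥ 2, ν < xᵢ < 1 − ν, ∑ xᵢ = 1}` contradict each other at `x = (1/2, 1/2)`.  No `sorry`. -/
theorem FMThm73aLevelHalf_holds :
    Summit.Parity.GeneralizedHardyLittlewood.Theses.FordMaynardSieveConst01651.FMThm73aLevelHalf := by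
  intro ν hν hν4 g _hs _hpc h0 hsupp hH c _hc
  exfalso
  have h := hH 2 le_rfl (fun _ => (1 / 2 : ℝ)) (fun _ => ⟨by linarith, by linarith⟩)
    (by simp only [Finset.sum_const, Finset.card_univ, Fintype.card_fin, nsmul_eq_mul]; norm_num)
  rw [starSum_const_half h0 hsupp 2] at h
  norm_num at h

/-- The Literature named fact itself is a theorem (vacuous), same proof. -/
theorem FordMaynard2024_thm73a_levelHalf_holds : FordMaynard2024_thm73a_levelHalf := FMThm73aLevelHalf_holds

/-- **`GCert01651` is false** (item stmt-Parity-19186, crux rank 2 of the route): any `g` with clauses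
`g(∅) = 1` and strict support has `(𝟙⋆g)(1/2, 1/2) = 1 > 0`, violating the sign clause at `k = 2`.  No `sorry`. -/
theorem not_GCert01651 :
    ¬ Summit.Parity.GeneralizedHardyLittlewood.Theses.FordMaynardSieveConst01651.GCert01651 := by
  rintro ⟨g, -, -, h0, hsupp, hH, -⟩
  have h := hH 2 le_rfl (fun _ => (1 / 2 : ℝ)) (fun _ => ⟨by norm_num, by norm_num⟩)
    (by simp only [Finset.sum_const, Finset.card_univ, Fintype.card_fin, nsmul_eq_mul]; norm_num)
  rw [starSum_const_half h0 hsupp 2] at h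
  norm_num at h

/-- Consequently the route's assembly `GCert01651 → FMThm73aLevelHalf → SieveConst01651` carries no information:
its first hypothesis is refutable and its second is a theorem. (Recorded for the census; `Assembly` itself was
landed as `assembly_holds`.) -/
theorem assembly_premises : ¬ Theses.FordMaynardSieveConst01651.GCert01651 ∧
    Theses.FordMaynardSieveConst01651.FMThm73aLevelHalf :=
  ⟨not_GCert01651, FMThm73aLevelHalf_holds⟩

/-- The stub of this seat's two registered lines (`Lines/cone_table.lean` for `GCert01651`,
`Lines/cone_table_bridge.lean` for `SieveConst01651`), restated verbatim. -/
def Signature.stub_coneCert : Prop :=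
  ∃ g₀ : VecFn, IsPiecewiseConstOnCone g₀ ∧ (∀ e : Fin 0 → ℝ, g₀ 0 e = 1) ∧
    (∀ (k : ℕ) (x : Fin k → ℝ), Monotone x → g₀ k x ≠ 0 →
      k = 0 ∨ ((∀ i, (1651 / 10000 : ℝ) < x i) ∧ ∑ i, x i < 1 / 2)) ∧
    (∀ k : ℕ, 2 ≤ k → k ≤ 6 → ∀ x : Fin k → ℝ, Monotone x →
      (∀ i, (1651 / 10000 : ℝ) < x i ∧ x i < 1 - 1651 / 10000) → ∑ i, x i = 1 → starSum g₀ k x ≤ 0) ∧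
    0 < sieveBoundG1 (1651 / 10000) g₀

/-- **DIAGNOSIS: `stub_coneCert` is false** — the constant vector `(1/2, 1/2)` is monotone, so the cone-restricted
support clause still kills `g₀(1/2)` and `g₀(1/2,1/2)`, and the cone-restricted sign clause still applies at it. -/
theorem not_stub_coneCert : ¬ Signature.stub_coneCert := by
  classical
  rintro ⟨g, -, h0, hsupp, hH, -⟩
  have hmono : ∀ k : ℕ, Monotone (fun _ : Fin k => (1 / 2 : ℝ)) := fun k _ _ _ => le_rfl
  -- the support clause restricted to monotone vectors suffices for the constant vector in every dimension
  have h0' : ∀ (m : ℕ), m = 0 → ∀ e : Fin m → ℝ, g m e = 1 := by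
    rintro m rfl e; exact h0 e
  have hstar : starSum g 2 (fun _ => (1 / 2 : ℝ)) = 1 := by
    unfold starSum
    have key : ∀ A : Finset (Fin 2),
        g A.card (fun i => (fun _ : Fin 2 => (1 / 2 : ℝ)) (A.orderEmbOfFin rfl i)) = if A = ∅ then 1 else 0 := by
      intro A
      by_cases hA : A = ∅
      · rw [if_pos hA]
        exact h0' _ (by rw [hA]; rfl) _
      · rw [if_neg hA]
        by_contra hne
        rcases hsupp _ _ (hmono _) hne with h | ⟨-, hlt⟩
        · exact hA (Finset.card_eq_zero.1 h)
        · simp only [Finset.sum_const, Finset.card_univ, Fintype.card_fin, nsmul_eq_mul] at hlt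
          have h1 : (1 : ℝ) ≤ A.card := by
            exact_mod_cast Finset.card_pos.2 (Finset.nonempty_iff_ne_empty.2 hA)
          linarith
    simp_rw [key]
    simp
  have h := hH 2 le_rfl (by norm_num) (fun _ => (1 / 2 : ℝ)) (hmono 2) (fun _ => ⟨by norm_num, by norm_num⟩)
    (by simp only [Finset.sum_const, Finset.card_univ, Fintype.card_fin, nsmul_eq_mul]; norm_num)
  rw [hstar] at h
  norm_num at h

end Summit.Parity.GeneralizedHardyLittlewood.Cruxes.FMThm73aLevelHalf.ClosedPoint

end
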